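import Summits.HodgeConjecture.HodgeConjecture.Theorems.F0P3cStCharTSKeysFields          -- ★ p851228 (LH6-p04 g5) «KEYS-FIELDS★»: `exists_keysPair_fields` (the Keys pair as total functions of the PARAMETER pair), `piNNotL2_of_keysFields`, `pi2_isL2_of_keysFields`; brings ★ Pi2SqInt, ★ `keysCaseTwo_holds`, ★ Ch12Sec5Inputs
import Literature.NumberTheory.Rogawski1990.SemilocalQuadraticCharExtension              -- ★ `isQuadraticCharExtension_semilocalComponent_of_baseChange_eq` (the organs' `μ_v`)
import Literature.NumberTheory.Rogawski1990.XiLocalCharacter                             -- ★ `localDet`, `OneDimAutRepH.xiLocalChar`, `xiLocalChar_apply_eq`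
import Literature.NumberTheory.Automorphic.LocalNormOneHilbert90                         -- ★ `localDet_one_surjective`, `localDet_two_surjective`
import Literature.NumberTheory.Automorphic.TorusCharacterLocalComponents                 -- ★ `continuous_semilocalComponent`, `continuous_torusLocalComponent`
import HarnessLib

/-!
# F0 · P3c · line LH6 «StCharTS» — brick «XI-DICT★» (datum road, slice S6 completed): THE PARAMETER EXTRACTION `ξ′ ↦ (η₁, η₂)` ON `H_v = U(Φ₂)(L⁺_v) × U(Φ₁)(L⁺_v)`,
# and the (S-𝔇) label fields `pi2, piN` AS FUNCTIONS OF `ξ′ : H_v →* ℂˣ` with (PI2-L2), (PIN) and the Keys labels, BY NAME over ★ «KEYS-FIELDS★»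

Cell `hodgecm-mathlib`, crux `H413` (`stmt-HodgeConjecture-24833`), line LH6 `Cruxes/H413/Lines/F0_P3c_StCharTSPaydown.lean` (organ (S-𝔇) `stub_EllipticPackage`:
an existential over a §12.5 datum `𝔇 : Ch12Sec5.EllipticData (U(Φ₃)(L⁺_v)) (H_v)`, `H_v = HLoc L v`; among its conjuncts «(PI2-L2) `∀ ξ′, Continuous ξ′ → 𝔇.IsL2 (𝔇.pi2 ξ′)`»
and (PIN) ★ `EllipticData.PiNNotL2`).  Seat LH6-p03 (g4); THEOREMS ONLY (no `def`, no named fact, no `instance`, no notation, no `sorry`; axioms ⊆ {propext,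
Classical.choice, Quot.sound}); `--supports stmt-HodgeConjecture-24833`.  Datum-road slice S6 of LH6-p01 (g4)'s MAP-DATUM-ROAD v1 (c27052c38efdd9c4), COMPLETED:
★ p851228 «KEYS-FIELDS★» (LH6-p04 (g5)) delivers the label fields as functions `pi2′, piN′` of the PARAMETER PAIR `(η₁, η₂)` and states its datum theorem through an
arbitrary «parameter extraction `ext : (H →* ℂˣ) → (η₁, η₂)` sending continuous `ξ′` to continuous pairs», left to the constructor; THIS file supplies `ext` on
print's `H_v` (the dictionary «`ξ(h) = η′(det₀ h)·χ₂(det h)`», [Rogawski1990, §12.2 (2) p. 173; §13.3 p. 202]), proves it is single-valued, and composes — so the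
constructor's field equations are the plain `𝔇.pi2 = pi2`, `𝔇.piN = piN` (MAP §2 rule 1).
HONEST LABEL: HC_CM is proved only modulo the 7 printed citations (2 remaining: hLiu418 = stmt-HodgeConjecture-24832, h413 = stmt-HodgeConjecture-24833) until rung 0
closes; count-neutral (no leaf edition; at the concrete datum (PI2-L2) and (PIN) are in-house theorems over ★ `keysCaseTwo_holds`).

THE MATHEMATICS.  A one-dimensional representation of `H = U(2) × U(1)` is `ξ(h₀, u) = η′(det₀ h₀) · χ₂(det(h₀, u))` with `det(h₀, u) = det₀ h₀ · u` [§12.2 p. 173;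
§4.8 (a); §3.13], i.e. in the tree's local currency `ξ′(h₀, u) = η₁(det₀ h₀) · η₂(det₀ h₀ · det u)` for characters `η₁, η₂` of `E¹_v` (`det₀`, `det` = ★ `localDet` on
the two factors; for a GLOBAL `ξ = (η, ψ)` this is ★ `OneDimAutRepH.xiLocalChar_apply_eq` with `(η₁, η₂) = (η_v, ψ_v)`).  §1: the pair is UNIQUE — both local
determinants are ONTO `E¹_v` (★ `localDet_one_surjective`, ★ `localDet_two_surjective` = local Hilbert 90), so `η₂(t) = ξ′(g, u)` for `det₀ g = 1`, `det u = t`,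
and then `η₁(t) = ξ′(g, u)` for `det₀ g = t`, `det u = t⁻¹`.  §2: hence a total EXTRACTION `ext : (H_v →* ℂˣ) → (E¹_v →* ℂˣ)²` exists (choice, guarded by «some
CONTINUOUS pair decomposes `ξ′`», else the trivial pair): `ext ξ′` is always a continuous pair, and `ext ξ′ = (η₁, η₂)` whenever a continuous pair `(η₁, η₂)`
decomposes `ξ′`; in particular `ext (ξ_v) = (η_v, ψ_v)` at every global `ξ`.  (Every continuous `ξ′` IS decomposable — `SU(1,1)(L⁺_v)` is perfect — but that
is not needed: the sockets only ever read `pi2 ξ′`, `piN ξ′`, which are genuine Keys pairs in both branches.)  §3: composing with ★ «KEYS-FIELDS★»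
(`pi2 := pi2′ ∘ ext`, `piN := piN′ ∘ ext`): total functions of `ξ′` which are square-integrable ∕ not square-integrable modulo the centre for EVERY `ξ′`, are the
Keys-labelled pair of `i_G(cmXiTorusChar L v μ_v η₁ η₂)` at every continuously-decomposable `ξ′` (so `(pi2 ξ′, piN ξ′) = (π²(ξ′), πⁿ(ξ′))` of [§12.2 (2)]) — in
particular at the organs' `ξ_v` with the organs' parameters `((ξ.η)_v, (ξ.ψ)_v)` (the (S-i) junction: the datum's `π²` IS the organs' Keys label) — and for which
every datum `𝔇` with `𝔇.pi2 = pi2`, `𝔇.piN = piN`, `𝔇.μGZ = μZ` satisfies (PIN) and (PI2-L2) TOKEN FOR TOKEN.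

## References
* [Rogawski1990] J. D. Rogawski, *Automorphic Representations of Unitary Groups in Three Variables*, Ann. of Math. Stud. 123 (1990): §12.2 (2) pp. 173–174
  («define a character `ξ` of `H` by `ξ(h) = η′(det₀(h))χ₂(det(h))`. Then `ξ` determines `χ`»; `π²(ξ)`, `πⁿ(ξ)`); §13.3 p. 202 («`ξ(h) = η(det₀ h) ψ(det h)`»);
  §3.13 (`det₀`); §4.8 Case (a) (`det (ι h) = det₀ h · u`); §1.9–1.10 pp. 8–9 (local Hilbert 90).
* [Keys1984] D. Keys, *Principal series representations of special unitary groups over local fields*, Compositio Math. 51 (1984), §7 Thm. p. 126.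
-/

set_option autoImplicit false
-- the mandated namespace has the single-problem summit's repeated segment (`HodgeConjecture.HodgeConjecture`)
set_option linter.dupNamespace false

noncomputable section

open NumberField IsDedekindDomain MeasureTheory
open scoped Matrix

open Literature.NumberTheory Literature.NumberTheory.Automorphic Literature.NumberTheory.Automorphic.UnitaryGroup
open Literature.NumberTheory.GaloisRepresentations
open Literature.NumberTheory.Rogawski1990

namespace Summit.HodgeConjecture.HodgeConjecture.Cruxes.H413.F0P3cStCharTSXiDict

variable {L : Type} [Field L] [NumberField L] [IsCMField L]

/-! ## §1 The dictionary `ξ′(h₀, u) = η₁(det₀ h₀) · η₂(det₀ h₀ · det u)` on `H_v`: the pair `(η₁, η₂)` is unique -/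

section Dictionary

variable (v : HeightOneSpectrum (𝓞 ↥(maximalRealSubfield L)))

/-- **`η₂` is determined**: if `ξ′(h₀, u) = η₁(det₀ h₀)·η₂(det₀ h₀·det u)` for all `(h₀, u)`, then `η₂ t = ξ′(g, u)` for any `g` with `det₀ g = 1` and `u` with
`det u = t` (both determinants are onto `E¹_v`: ★ `localDet_two_surjective`, ★ `localDet_one_surjective`), so two decompositions of the same `ξ′` have the same `η₂`.
[cite: Rogawski1990, §12.2 (2) p. 173; §3.13] -/
theorem pair_unique_snd
    (ξ' : (UnitaryGroup.cmDatum L 2 (Matrix.of fun i j : Fin 2 => if i.val + j.val + 1 = 2 then (1 : L) else 0)).Local v ×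
        (UnitaryGroup.cmDatum L 1 (Matrix.of fun i j : Fin 1 => if i.val + j.val + 1 = 1 then (1 : L) else 0)).Local v →* ℂˣ)
    (η₁ η₂ η₁' η₂' : ↥(normOneUnits (conjLocal L (IsCMField.complexConj L) v)) →* ℂˣ)
    (h : ∀ hh, ξ' hh = η₁ (localDet (IsCMField.complexConj L) v (isUnit_antidiagOne_det L 2) hh.1) *
      η₂ (localDet (IsCMField.complexConj L) v (isUnit_antidiagOne_det L 2) hh.1 * localDet (IsCMField.complexConj L) v (isUnit_antidiagOne_det L 1) hh.2))
    (h' : ∀ hh, ξ' hh = η₁' (localDet (IsCMField.complexConj L) v (isUnit_antidiagOne_det L 2) hh.1) *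
      η₂' (localDet (IsCMField.complexConj L) v (isUnit_antidiagOne_det L 2) hh.1 * localDet (IsCMField.complexConj L) v (isUnit_antidiagOne_det L 1) hh.2)) :
    η₂ = η₂' := by
  ext t
  -- `(g, u)` with `det₀ g = 1`, `det u = t`
  obtain ⟨g, hg⟩ := localDet_two_surjective L v 1
  obtain ⟨u, hu⟩ := localDet_one_surjective L v t
  have h1 := h (g, u)
  have h2 := h' (g, u)
  simp only [hg, hu, map_one, one_mul] at h1 h2
  rw [← h1, ← h2]

/-- **`η₁` is determined**: with `(g, u)` such that `det₀ g = t` and `det u = t⁻¹`, `ξ′(g, u) = η₁(t)·η₂(1) = η₁(t)`; so two decompositions of the same `ξ′` have the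
same `η₁`. [cite: Rogawski1990, §12.2 (2) p. 173; §3.13] -/
theorem pair_unique_fst
    (ξ' : (UnitaryGroup.cmDatum L 2 (Matrix.of fun i j : Fin 2 => if i.val + j.val + 1 = 2 then (1 : L) else 0)).Local v ×
        (UnitaryGroup.cmDatum L 1 (Matrix.of fun i j : Fin 1 => if i.val + j.val + 1 = 1 then (1 : L) else 0)).Local v →* ℂˣ)
    (η₁ η₂ η₁' η₂' : ↥(normOneUnits (conjLocal L (IsCMField.complexConj L) v)) →* ℂˣ)
    (h : ∀ hh, ξ' hh = η₁ (localDet (IsCMField.complexConj L) v (isUnit_antidiagOne_det L 2) hh.1) *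
      η₂ (localDet (IsCMField.complexConj L) v (isUnit_antidiagOne_det L 2) hh.1 * localDet (IsCMField.complexConj L) v (isUnit_antidiagOne_det L 1) hh.2))
    (h' : ∀ hh, ξ' hh = η₁' (localDet (IsCMField.complexConj L) v (isUnit_antidiagOne_det L 2) hh.1) *
      η₂' (localDet (IsCMField.complexConj L) v (isUnit_antidiagOne_det L 2) hh.1 * localDet (IsCMField.complexConj L) v (isUnit_antidiagOne_det L 1) hh.2)) :
    η₁ = η₁' := by
  ext t
  obtain ⟨g, hg⟩ := localDet_two_surjective L v t
  obtain ⟨u, hu⟩ := localDet_one_surjective L v t⁻¹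
  have h1 := h (g, u)
  have h2 := h' (g, u)
  simp only [hg, hu, mul_inv_cancel, map_one, mul_one] at h1 h2
  rw [← h1, ← h2]

/-- **The two determinations together**: the decomposing pair is unique. [cite: Rogawski1990, §12.2 (2) p. 173 («`ξ` determines `χ`»); §3.13] -/
theorem pair_unique
    (ξ' : (UnitaryGroup.cmDatum L 2 (Matrix.of fun i j : Fin 2 => if i.val + j.val + 1 = 2 then (1 : L) else 0)).Local v ×
        (UnitaryGroup.cmDatum L 1 (Matrix.of fun i j : Fin 1 => if i.val + j.val + 1 = 1 then (1 : L) else 0)).Local v →* ℂˣ)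
    (η η' : (↥(normOneUnits (conjLocal L (IsCMField.complexConj L) v)) →* ℂˣ) × (↥(normOneUnits (conjLocal L (IsCMField.complexConj L) v)) →* ℂˣ))
    (h : ∀ hh, ξ' hh = η.1 (localDet (IsCMField.complexConj L) v (isUnit_antidiagOne_det L 2) hh.1) *
      η.2 (localDet (IsCMField.complexConj L) v (isUnit_antidiagOne_det L 2) hh.1 * localDet (IsCMField.complexConj L) v (isUnit_antidiagOne_det L 1) hh.2))
    (h' : ∀ hh, ξ' hh = η'.1 (localDet (IsCMField.complexConj L) v (isUnit_antidiagOne_det L 2) hh.1) *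
      η'.2 (localDet (IsCMField.complexConj L) v (isUnit_antidiagOne_det L 2) hh.1 * localDet (IsCMField.complexConj L) v (isUnit_antidiagOne_det L 1) hh.2)) :
    η = η' :=
  Prod.ext (pair_unique_fst v ξ' _ _ _ _ h h') (pair_unique_snd v ξ' _ _ _ _ h h')

/-- The ℂ-valued form of the trivial character of `E¹_v` is continuous (a constant). [cite: Rogawski1990, §12.2 p. 174] -/
theorem continuous_one_normOneUnits :
    Continuous (fun x : ↥(normOneUnits (conjLocal L (IsCMField.complexConj L) v)) =>
      (((1 : ↥(normOneUnits (conjLocal L (IsCMField.complexConj L) v)) →* ℂˣ) x : ℂˣ) : ℂ)) := by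
  simp only [MonoidHom.one_apply, Units.val_one]
  exact continuous_const

/-- **The global `ξ_v` decomposes with the pair `((ξ.η)_v, (ξ.ψ)_v)`** — ★ `OneDimAutRepH.xiLocalChar_apply_eq`, read as the dictionary hypothesis.
[cite: Rogawski1990, §13.3 p. 202; §12.2 (2) p. 173] -/
theorem xiLocalChar_isPair (ξ : OneDimAutRepH L) :
    ∀ hh, ξ.xiLocalChar v hh = torusLocalComponent L (IsCMField.complexConj L) v ξ.η (localDet (IsCMField.complexConj L) v (isUnit_antidiagOne_det L 2) hh.1) *
      torusLocalComponent L (IsCMField.complexConj L) v ξ.ψ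
        (localDet (IsCMField.complexConj L) v (isUnit_antidiagOne_det L 2) hh.1 * localDet (IsCMField.complexConj L) v (isUnit_antidiagOne_det L 1) hh.2) :=
  fun hh => OneDimAutRepH.xiLocalChar_apply_eq ξ v hh

end Dictionary

/-! ## §2 The parameter extraction `ext : (H_v →* ℂˣ) → (E¹_v →* ℂˣ) × (E¹_v →* ℂˣ)` -/

section Extraction

variable (v : HeightOneSpectrum (𝓞 ↥(maximalRealSubfield L)))

/-- **«XI-DICT★» — THE PARAMETER EXTRACTION EXISTS.**  There is a total function `ext` on the characters `ξ′ : H_v →* ℂˣ` with values in pairs of characters of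
`E¹_v` such that (a) `ext ξ′` is ALWAYS a continuous pair (ℂ-valued continuity, the currency of ★ `KeysCaseTwo` ∕ ★ «KEYS-FIELDS★»'s `hext`), and (b) whenever a
continuous pair `(η₁, η₂)` decomposes `ξ′` — `ξ′(h₀, u) = η₁(det₀ h₀) · η₂(det₀ h₀ · det u)` — then `ext ξ′ = (η₁, η₂)` (§1 uniqueness).  Construction: choice guarded by
«some continuous pair decomposes `ξ′`», else the trivial pair. [cite: Rogawski1990, §12.2 (2) p. 173; §13.3 p. 202] -/
theorem exists_xiDict :
    ∃ ext : ((UnitaryGroup.cmDatum L 2 (Matrix.of fun i j : Fin 2 => if i.val + j.val + 1 = 2 then (1 : L) else 0)).Local v ×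
          (UnitaryGroup.cmDatum L 1 (Matrix.of fun i j : Fin 1 => if i.val + j.val + 1 = 1 then (1 : L) else 0)).Local v →* ℂˣ) →
        (↥(normOneUnits (conjLocal L (IsCMField.complexConj L) v)) →* ℂˣ) × (↥(normOneUnits (conjLocal L (IsCMField.complexConj L) v)) →* ℂˣ),
      (∀ ξ', Continuous (fun x => (((ext ξ').1 x : ℂˣ) : ℂ)) ∧ Continuous (fun x => (((ext ξ').2 x : ℂˣ) : ℂ))) ∧
      ∀ (η₁ η₂ : ↥(normOneUnits (conjLocal L (IsCMField.complexConj L) v)) →* ℂˣ),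
        Continuous (fun x => ((η₁ x : ℂˣ) : ℂ)) → Continuous (fun x => ((η₂ x : ℂˣ) : ℂ)) →
        ∀ ξ', (∀ hh, ξ' hh = η₁ (localDet (IsCMField.complexConj L) v (isUnit_antidiagOne_det L 2) hh.1) *
            η₂ (localDet (IsCMField.complexConj L) v (isUnit_antidiagOne_det L 2) hh.1 * localDet (IsCMField.complexConj L) v (isUnit_antidiagOne_det L 1) hh.2)) →
          ext ξ' = (η₁, η₂) := by
  classical
  -- the dictionary predicate and decomposability by a CONTINUOUS pair
  let P : (((UnitaryGroup.cmDatum L 2 (Matrix.of fun i j : Fin 2 => if i.val + j.val + 1 = 2 then (1 : L) else 0)).Local v ×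
          (UnitaryGroup.cmDatum L 1 (Matrix.of fun i j : Fin 1 => if i.val + j.val + 1 = 1 then (1 : L) else 0)).Local v →* ℂˣ)) →
      (↥(normOneUnits (conjLocal L (IsCMField.complexConj L) v)) →* ℂˣ) × (↥(normOneUnits (conjLocal L (IsCMField.complexConj L) v)) →* ℂˣ) → Prop :=
    fun ξ' η => ∀ hh, ξ' hh = η.1 (localDet (IsCMField.complexConj L) v (isUnit_antidiagOne_det L 2) hh.1) *
      η.2 (localDet (IsCMField.complexConj L) v (isUnit_antidiagOne_det L 2) hh.1 * localDet (IsCMField.complexConj L) v (isUnit_antidiagOne_det L 1) hh.2)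
  let D : (((UnitaryGroup.cmDatum L 2 (Matrix.of fun i j : Fin 2 => if i.val + j.val + 1 = 2 then (1 : L) else 0)).Local v ×
          (UnitaryGroup.cmDatum L 1 (Matrix.of fun i j : Fin 1 => if i.val + j.val + 1 = 1 then (1 : L) else 0)).Local v →* ℂˣ)) → Prop :=
    fun ξ' => ∃ η, Continuous (fun x => ((η.1 x : ℂˣ) : ℂ)) ∧ Continuous (fun x => ((η.2 x : ℂˣ) : ℂ)) ∧ P ξ' η
  refine ⟨fun ξ' => if hξ : D ξ' then hξ.choose else 1, fun ξ' => ?_, fun η₁ η₂ h1 h2 ξ' hξ' => ?_⟩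
  · by_cases hξ : D ξ'
    · simp only [dif_pos hξ]
      exact ⟨hξ.choose_spec.1, hξ.choose_spec.2.1⟩
    · simp only [dif_neg hξ, Prod.fst_one, Prod.snd_one]
      exact ⟨continuous_one_normOneUnits v, continuous_one_normOneUnits v⟩
  · have hD : D ξ' := ⟨(η₁, η₂), h1, h2, hξ'⟩
    simp only [dif_pos hD]
    exact pair_unique v ξ' hD.choose (η₁, η₂) hD.choose_spec.2.2 hξ'

/-- **At the global `ξ_v` the extraction returns the organs' parameters**: for any `ext` with property (b) of ★ `exists_xiDict`, `ext (ξ.xiLocalChar v) = ((ξ.η)_v, (ξ.ψ)_v)`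
(★ `xiLocalChar_isPair`, ★ `continuous_torusLocalComponent`). [cite: Rogawski1990, §13.3 p. 202; §12.2 (2) p. 173] -/
theorem xiDict_xiLocalChar
    {ext : ((UnitaryGroup.cmDatum L 2 (Matrix.of fun i j : Fin 2 => if i.val + j.val + 1 = 2 then (1 : L) else 0)).Local v ×
          (UnitaryGroup.cmDatum L 1 (Matrix.of fun i j : Fin 1 => if i.val + j.val + 1 = 1 then (1 : L) else 0)).Local v →* ℂˣ) →
        (↥(normOneUnits (conjLocal L (IsCMField.complexConj L) v)) →* ℂˣ) × (↥(normOneUnits (conjLocal L (IsCMField.complexConj L) v)) →* ℂˣ)}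
    (hext : ∀ (η₁ η₂ : ↥(normOneUnits (conjLocal L (IsCMField.complexConj L) v)) →* ℂˣ),
        Continuous (fun x => ((η₁ x : ℂˣ) : ℂ)) → Continuous (fun x => ((η₂ x : ℂˣ) : ℂ)) →
        ∀ ξ', (∀ hh, ξ' hh = η₁ (localDet (IsCMField.complexConj L) v (isUnit_antidiagOne_det L 2) hh.1) *
            η₂ (localDet (IsCMField.complexConj L) v (isUnit_antidiagOne_det L 2) hh.1 * localDet (IsCMField.complexConj L) v (isUnit_antidiagOne_det L 1) hh.2)) →
          ext ξ' = (η₁, η₂))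
    (ξ : OneDimAutRepH L) :
    ext (ξ.xiLocalChar v) = (torusLocalComponent L (IsCMField.complexConj L) v ξ.η, torusLocalComponent L (IsCMField.complexConj L) v ξ.ψ) :=
  hext _ _ (continuous_torusLocalComponent L (IsCMField.complexConj L) ξ.η) (continuous_torusLocalComponent L (IsCMField.complexConj L) ξ.ψ)
    (ξ.xiLocalChar v) (xiLocalChar_isPair v ξ)

end Extraction

/-! ## §3 The label fields as functions of `ξ′ : H_v →* ℂˣ`: ★ «KEYS-FIELDS★» composed with the extraction -/

section Fields

/-- **(PIN) and (PI2-L2) TOKEN FOR TOKEN at a datum whose label fields are square-integrable ∕ not square-integrable for EVERY `ξ′`** (the shape the composed fields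
have): `𝔇.PiNNotL2` and `∀ ξ′, Continuous ξ′ → 𝔇.IsL2 (𝔇.pi2 ξ′)` from the plain field equations `𝔇.pi2 = pi2`, `𝔇.piN = piN`, `𝔇.μGZ = μZ`.
[cite: Rogawski1990, §12.2 (2) pp. 173–174] -/
theorem keysFields_sockets {v : HeightOneSpectrum (𝓞 ↥(maximalRealSubfield L))}
    [MeasurableSpace (Gqs L v)] [∀ γ : Gqs L v, MeasurableSpace (Gqs L v ⧸ Subgroup.centralizer ({γ} : Set (Gqs L v)))]
    [MeasurableSpace (Gqs L v ⧸ Subgroup.center (Gqs L v))]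
    [MeasurableSpace ((UnitaryGroup.cmDatum L 2 (Matrix.of fun i j : Fin 2 => if i.val + j.val + 1 = 2 then (1 : L) else 0)).Local v ×
        (UnitaryGroup.cmDatum L 1 (Matrix.of fun i j : Fin 1 => if i.val + j.val + 1 = 1 then (1 : L) else 0)).Local v)]
    (𝔇 : Ch12Sec5.EllipticData (Gqs L v)
      ((UnitaryGroup.cmDatum L 2 (Matrix.of fun i j : Fin 2 => if i.val + j.val + 1 = 2 then (1 : L) else 0)).Local v ×
        (UnitaryGroup.cmDatum L 1 (Matrix.of fun i j : Fin 1 => if i.val + j.val + 1 = 1 then (1 : L) else 0)).Local v))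
    (μZ : Measure (Gqs L v ⧸ Subgroup.center (Gqs L v)))
    {pi2 piN : ((UnitaryGroup.cmDatum L 2 (Matrix.of fun i j : Fin 2 => if i.val + j.val + 1 = 2 then (1 : L) else 0)).Local v ×
          (UnitaryGroup.cmDatum L 1 (Matrix.of fun i j : Fin 1 => if i.val + j.val + 1 = 1 then (1 : L) else 0)).Local v →* ℂˣ) → IrrClass (Gqs L v)}
    (hL2 : ∀ ξ', (pi2 ξ').IsSquareIntegrable μZ ∧ ¬ (piN ξ').IsSquareIntegrable μZ)
    (hpi2 : 𝔇.pi2 = pi2) (hpiN : 𝔇.piN = piN) (hμGZ : 𝔇.μGZ = μZ) :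
    𝔇.PiNNotL2 ∧
      ∀ ξ' : ((UnitaryGroup.cmDatum L 2 (Matrix.of fun i j : Fin 2 => if i.val + j.val + 1 = 2 then (1 : L) else 0)).Local v ×
          (UnitaryGroup.cmDatum L 1 (Matrix.of fun i j : Fin 1 => if i.val + j.val + 1 = 1 then (1 : L) else 0)).Local v →* ℂˣ),
        Continuous ξ' → 𝔇.IsL2 (𝔇.pi2 ξ') := by
  refine ⟨fun ξ' _ => ?_, fun ξ' _ => ?_⟩
  · simp only [Ch12Sec5.EllipticData.IsL2, hpiN, hμGZ]
    exact (hL2 ξ').2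
  · simp only [Ch12Sec5.EllipticData.IsL2, hpi2, hμGZ]
    exact (hL2 ξ').1

/-- **«XI-DICT★» ∘ «KEYS-FIELDS★» — THE LABEL FIELDS `pi2, piN : (H_v →* ℂˣ) → E(U(Φ₃)(L⁺_v))` OF THE §12.5 DATUM, AS FUNCTIONS OF `ξ′`.**  At the organs' tokens — a
Hecke character `μ` with `μ|_{𝕀_{L⁺}} = ω_{L/L⁺}` (`hμω`), a NON-SPLIT `v` (`hns`), a Haar measure `μZ` on `U(Φ₃)(L⁺_v) ⧸ Z` — there are total functions `pi2, piN`
with: (a) for EVERY `ξ′`, `pi2 ξ′` is square-integrable modulo the centre and `piN ξ′` is not; (b) for every continuous pair `(η₁, η₂)` and every `ξ′` it decomposes,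
`(pi2 ξ′, piN ξ′)` is the Keys-labelled pair of `i_G(cmXiTorusChar L v μ_v η₁ η₂)` (★ `KeysCaseTwoLabels`), i.e. `(π²(ξ′), πⁿ(ξ′))` of [§12.2 (2)]; (c) in particular,
at every global `ξ`, `(pi2 (ξ_v), piN (ξ_v))` is Keys-labelled at the organs' parameters `((ξ.η)_v, (ξ.ψ)_v)` — the junction with (S-i)'s `π²`; (d) every datum
`𝔇 : EllipticData (U(Φ₃)(L⁺_v)) H_v` with `𝔇.pi2 = pi2`, `𝔇.piN = piN`, `𝔇.μGZ = μZ` satisfies (PIN) ★ `PiNNotL2` and (PI2-L2), TOKEN FOR TOKEN.  Proof: `pi2 := pi2′ ∘ ext`,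
`piN := piN′ ∘ ext` with `(pi2′, piN′)` = ★ `F0P3cStCharTSKeysFields.exists_keysPair_fields` (LH6-p04 (g5)) and `ext` = §2.
[cite: Rogawski1990, §12.2 (2) pp. 173–174; §13.3 p. 202] [cite: Keys1984, §7 Thm. p. 126] -/
theorem exists_keysFields_Hv (μ : HeckeCharacter L)
    (hμω : ∀ x : Literature.NumberTheory.GaloisRepresentations.ideleGroup ↥(maximalRealSubfield L),
      μ (AdeleRing.ideleBaseChange (↥(maximalRealSubfield L)) L x) = quadraticHeckeCharCM L x)
    (v : HeightOneSpectrum (𝓞 ↥(maximalRealSubfield L))) (hns : ∀ w : PlacesOver L v, IsCMField.complexConj L • w.1 = w.1)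
    [MeasurableSpace (Gqs L v)] [∀ γ : Gqs L v, MeasurableSpace (Gqs L v ⧸ Subgroup.centralizer ({γ} : Set (Gqs L v)))]
    [MeasurableSpace (Gqs L v ⧸ Subgroup.center (Gqs L v))] [BorelSpace (Gqs L v ⧸ Subgroup.center (Gqs L v))]
    [MeasurableSpace ((UnitaryGroup.cmDatum L 2 (Matrix.of fun i j : Fin 2 => if i.val + j.val + 1 = 2 then (1 : L) else 0)).Local v ×
        (UnitaryGroup.cmDatum L 1 (Matrix.of fun i j : Fin 1 => if i.val + j.val + 1 = 1 then (1 : L) else 0)).Local v)]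
    (μZ : Measure (Gqs L v ⧸ Subgroup.center (Gqs L v))) [μZ.IsHaarMeasure] :
    ∃ pi2 piN : ((UnitaryGroup.cmDatum L 2 (Matrix.of fun i j : Fin 2 => if i.val + j.val + 1 = 2 then (1 : L) else 0)).Local v ×
          (UnitaryGroup.cmDatum L 1 (Matrix.of fun i j : Fin 1 => if i.val + j.val + 1 = 1 then (1 : L) else 0)).Local v →* ℂˣ) → IrrClass (Gqs L v),
      (∀ ξ', (pi2 ξ').IsSquareIntegrable μZ ∧ ¬ (piN ξ').IsSquareIntegrable μZ) ∧
      (∀ (η₁ η₂ : ↥(normOneUnits (conjLocal L (IsCMField.complexConj L) v)) →* ℂˣ),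
        Continuous (fun x => ((η₁ x : ℂˣ) : ℂ)) → Continuous (fun x => ((η₂ x : ℂˣ) : ℂ)) →
        ∀ ξ', (∀ hh, ξ' hh = η₁ (localDet (IsCMField.complexConj L) v (isUnit_antidiagOne_det L 2) hh.1) *
            η₂ (localDet (IsCMField.complexConj L) v (isUnit_antidiagOne_det L 2) hh.1 * localDet (IsCMField.complexConj L) v (isUnit_antidiagOne_det L 1) hh.2)) →
          KeysCaseTwoLabels L v (μ.semilocalComponent L v) η₁ η₂ (pi2 ξ') (piN ξ')) ∧
      (∀ ξ : OneDimAutRepH L,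
        KeysCaseTwoLabels L v (μ.semilocalComponent L v) (torusLocalComponent L (IsCMField.complexConj L) v ξ.η)
          (torusLocalComponent L (IsCMField.complexConj L) v ξ.ψ) (pi2 (ξ.xiLocalChar v)) (piN (ξ.xiLocalChar v))) ∧
      ∀ 𝔇 : Ch12Sec5.EllipticData (Gqs L v)
          ((UnitaryGroup.cmDatum L 2 (Matrix.of fun i j : Fin 2 => if i.val + j.val + 1 = 2 then (1 : L) else 0)).Local v ×
            (UnitaryGroup.cmDatum L 1 (Matrix.of fun i j : Fin 1 => if i.val + j.val + 1 = 1 then (1 : L) else 0)).Local v),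
        𝔇.pi2 = pi2 → 𝔇.piN = piN → 𝔇.μGZ = μZ →
          𝔇.PiNNotL2 ∧
            ∀ ξ' : ((UnitaryGroup.cmDatum L 2 (Matrix.of fun i j : Fin 2 => if i.val + j.val + 1 = 2 then (1 : L) else 0)).Local v ×
                (UnitaryGroup.cmDatum L 1 (Matrix.of fun i j : Fin 1 => if i.val + j.val + 1 = 1 then (1 : L) else 0)).Local v →* ℂˣ),
              Continuous ξ' → 𝔇.IsL2 (𝔇.pi2 ξ') := by
  -- the Keys pair as functions of the parameter pair (★ «KEYS-FIELDS★», LH6-p04 (g5)), at the organs' `μ_v`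
  obtain ⟨pi2', piN', hk⟩ := F0P3cStCharTSKeysFields.exists_keysPair_fields L v hns (μ.semilocalComponent L v)
    (isQuadraticCharExtension_semilocalComponent_of_baseChange_eq μ hμω v) (Units.continuous_val.comp (continuous_semilocalComponent L μ)) μZ
  -- the extraction (§2)
  obtain ⟨ext, hcont, hext⟩ := exists_xiDict v
  have hL2 : ∀ ξ', (pi2' (ext ξ')).IsSquareIntegrable μZ ∧ ¬ (piN' (ext ξ')).IsSquareIntegrable μZ := fun ξ' =>
    ⟨(hk (ext ξ') (hcont ξ').1 (hcont ξ').2).2.1, (hk (ext ξ') (hcont ξ').1 (hcont ξ').2).2.2⟩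
  refine ⟨fun ξ' => pi2' (ext ξ'), fun ξ' => piN' (ext ξ'), hL2, ?_, ?_, ?_⟩
  · intro η₁ η₂ h1 h2 ξ' hξ'
    -- transport on the PARAMETER side only: `ext ξ′ = (η₁, η₂)` inside `pi2′ ∕ piN′`
    show KeysCaseTwoLabels L v (μ.semilocalComponent L v) η₁ η₂ (pi2' (ext ξ')) (piN' (ext ξ'))
    rw [hext η₁ η₂ h1 h2 ξ' hξ']
    exact (hk (η₁, η₂) h1 h2).1
  · intro ξ
    show KeysCaseTwoLabels L v (μ.semilocalComponent L v) (torusLocalComponent L (IsCMField.complexConj L) v ξ.η)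
      (torusLocalComponent L (IsCMField.complexConj L) v ξ.ψ) (pi2' (ext (ξ.xiLocalChar v))) (piN' (ext (ξ.xiLocalChar v)))
    rw [xiDict_xiLocalChar v hext ξ]
    exact (hk (torusLocalComponent L (IsCMField.complexConj L) v ξ.η, torusLocalComponent L (IsCMField.complexConj L) v ξ.ψ)
      (continuous_torusLocalComponent L (IsCMField.complexConj L) ξ.η) (continuous_torusLocalComponent L (IsCMField.complexConj L) ξ.ψ)).1
  · intro 𝔇 hpi2 hpiN hμGZ
    exact keysFields_sockets 𝔇 μZ hL2 hpi2 hpiN hμGZ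

end Fields

/-! ## §4 (ED. 2) The label fields WITH their Keys labels at every `ξ′` — the `hlabels` input of ★ `ps2_kind3_of_fields` («KEYS-LABELS★») -/

section LabelFields

/-- **«KEYS-LABELS★» — ★ `exists_keysFields_Hv` with a fifth clause (e): for EVERY `ξ′ : H_v →* ℂˣ` there is a CONTINUOUS pair `(η₁, η₂)` (the extracted pair
`ext ξ′` of §2) at which `(pi2 ξ′, piN ξ′)` is the Keys-labelled pair of `i_G(cmXiTorusChar L v μ_v η₁ η₂)` (★ `KeysCaseTwoLabels`).**  Clause (e) is the `hlabels`
hypothesis of ★ `F0P3cStCharTSPs2Kind3.ps2_kind3_of_fields` ((PS2) for the Keys pairs — kind 3 of ★ `IsEllipticPair`) TOKEN FOR TOKEN at `μ := μ.semilocalComponent L v`,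
`H := H_v`, so at a datum with `𝔇.pi2 = pi2`, `𝔇.piN = piN` it is discharged by name; clauses (a)–(d) are ★ `exists_keysFields_Hv`'s, TOKEN FOR TOKEN, for the SAME
witnesses `pi2 := pi2′ ∘ ext`, `piN := piN′ ∘ ext` (★ `F0P3cStCharTSKeysFields.exists_keysPair_fields` composed with §2's `ext`, whose values are continuous pairs at
every `ξ′`). [cite: Rogawski1990, §12.2 (2) pp. 173–174; §13.3 p. 202] [cite: Keys1984, §7 Thm. p. 126] -/
theorem exists_keysFields_Hv_labels (μ : HeckeCharacter L)
    (hμω : ∀ x : Literature.NumberTheory.GaloisRepresentations.ideleGroup ↥(maximalRealSubfield L),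
      μ (AdeleRing.ideleBaseChange (↥(maximalRealSubfield L)) L x) = quadraticHeckeCharCM L x)
    (v : HeightOneSpectrum (𝓞 ↥(maximalRealSubfield L))) (hns : ∀ w : PlacesOver L v, IsCMField.complexConj L • w.1 = w.1)
    [MeasurableSpace (Gqs L v)] [∀ γ : Gqs L v, MeasurableSpace (Gqs L v ⧸ Subgroup.centralizer ({γ} : Set (Gqs L v)))]
    [MeasurableSpace (Gqs L v ⧸ Subgroup.center (Gqs L v))] [BorelSpace (Gqs L v ⧸ Subgroup.center (Gqs L v))]
    [MeasurableSpace ((UnitaryGroup.cmDatum L 2 (Matrix.of fun i j : Fin 2 => if i.val + j.val + 1 = 2 then (1 : L) else 0)).Local v ×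
        (UnitaryGroup.cmDatum L 1 (Matrix.of fun i j : Fin 1 => if i.val + j.val + 1 = 1 then (1 : L) else 0)).Local v)]
    (μZ : Measure (Gqs L v ⧸ Subgroup.center (Gqs L v))) [μZ.IsHaarMeasure] :
    ∃ pi2 piN : ((UnitaryGroup.cmDatum L 2 (Matrix.of fun i j : Fin 2 => if i.val + j.val + 1 = 2 then (1 : L) else 0)).Local v ×
          (UnitaryGroup.cmDatum L 1 (Matrix.of fun i j : Fin 1 => if i.val + j.val + 1 = 1 then (1 : L) else 0)).Local v →* ℂˣ) → IrrClass (Gqs L v),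
      (∀ ξ', (pi2 ξ').IsSquareIntegrable μZ ∧ ¬ (piN ξ').IsSquareIntegrable μZ) ∧
      (∀ (η₁ η₂ : ↥(normOneUnits (conjLocal L (IsCMField.complexConj L) v)) →* ℂˣ),
        Continuous (fun x => ((η₁ x : ℂˣ) : ℂ)) → Continuous (fun x => ((η₂ x : ℂˣ) : ℂ)) →
        ∀ ξ', (∀ hh, ξ' hh = η₁ (localDet (IsCMField.complexConj L) v (isUnit_antidiagOne_det L 2) hh.1) *
            η₂ (localDet (IsCMField.complexConj L) v (isUnit_antidiagOne_det L 2) hh.1 * localDet (IsCMField.complexConj L) v (isUnit_antidiagOne_det L 1) hh.2)) →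
          KeysCaseTwoLabels L v (μ.semilocalComponent L v) η₁ η₂ (pi2 ξ') (piN ξ')) ∧
      (∀ ξ : OneDimAutRepH L,
        KeysCaseTwoLabels L v (μ.semilocalComponent L v) (torusLocalComponent L (IsCMField.complexConj L) v ξ.η)
          (torusLocalComponent L (IsCMField.complexConj L) v ξ.ψ) (pi2 (ξ.xiLocalChar v)) (piN (ξ.xiLocalChar v))) ∧
      (∀ 𝔇 : Ch12Sec5.EllipticData (Gqs L v)
          ((UnitaryGroup.cmDatum L 2 (Matrix.of fun i j : Fin 2 => if i.val + j.val + 1 = 2 then (1 : L) else 0)).Local v ×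
            (UnitaryGroup.cmDatum L 1 (Matrix.of fun i j : Fin 1 => if i.val + j.val + 1 = 1 then (1 : L) else 0)).Local v),
        𝔇.pi2 = pi2 → 𝔇.piN = piN → 𝔇.μGZ = μZ →
          𝔇.PiNNotL2 ∧
            ∀ ξ' : ((UnitaryGroup.cmDatum L 2 (Matrix.of fun i j : Fin 2 => if i.val + j.val + 1 = 2 then (1 : L) else 0)).Local v ×
                (UnitaryGroup.cmDatum L 1 (Matrix.of fun i j : Fin 1 => if i.val + j.val + 1 = 1 then (1 : L) else 0)).Local v →* ℂˣ),
              Continuous ξ' → 𝔇.IsL2 (𝔇.pi2 ξ')) ∧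
      ∀ ξ' : ((UnitaryGroup.cmDatum L 2 (Matrix.of fun i j : Fin 2 => if i.val + j.val + 1 = 2 then (1 : L) else 0)).Local v ×
          (UnitaryGroup.cmDatum L 1 (Matrix.of fun i j : Fin 1 => if i.val + j.val + 1 = 1 then (1 : L) else 0)).Local v →* ℂˣ), Continuous ξ' →
        ∃ (η₁ η₂ : ↥(normOneUnits (conjLocal L (IsCMField.complexConj L) v)) →* ℂˣ),
          Continuous (fun x => ((η₁ x : ℂˣ) : ℂ)) ∧ Continuous (fun x => ((η₂ x : ℂˣ) : ℂ)) ∧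
            KeysCaseTwoLabels L v (μ.semilocalComponent L v) η₁ η₂ (pi2 ξ') (piN ξ') := by
  -- the Keys pair as functions of the parameter pair (★ «KEYS-FIELDS★», LH6-p04 (g5)), at the organs' `μ_v`
  obtain ⟨pi2', piN', hk⟩ := F0P3cStCharTSKeysFields.exists_keysPair_fields L v hns (μ.semilocalComponent L v)
    (isQuadraticCharExtension_semilocalComponent_of_baseChange_eq μ hμω v) (Units.continuous_val.comp (continuous_semilocalComponent L μ)) μZ
  -- the extraction (§2): `ext ξ′` is a CONTINUOUS pair at every `ξ′`
  obtain ⟨ext, hcont, hext⟩ := exists_xiDict v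
  have hL2 : ∀ ξ', (pi2' (ext ξ')).IsSquareIntegrable μZ ∧ ¬ (piN' (ext ξ')).IsSquareIntegrable μZ := fun ξ' =>
    ⟨(hk (ext ξ') (hcont ξ').1 (hcont ξ').2).2.1, (hk (ext ξ') (hcont ξ').1 (hcont ξ').2).2.2⟩
  refine ⟨fun ξ' => pi2' (ext ξ'), fun ξ' => piN' (ext ξ'), hL2, ?_, ?_, ?_, fun ξ' _ => ⟨(ext ξ').1, (ext ξ').2, (hcont ξ').1, (hcont ξ').2, ?_⟩⟩
  · intro η₁ η₂ h1 h2 ξ' hξ'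
    -- transport on the PARAMETER side only: `ext ξ′ = (η₁, η₂)` inside `pi2′ ∕ piN′`
    show KeysCaseTwoLabels L v (μ.semilocalComponent L v) η₁ η₂ (pi2' (ext ξ')) (piN' (ext ξ'))
    rw [hext η₁ η₂ h1 h2 ξ' hξ']
    exact (hk (η₁, η₂) h1 h2).1
  · intro ξ
    show KeysCaseTwoLabels L v (μ.semilocalComponent L v) (torusLocalComponent L (IsCMField.complexConj L) v ξ.η)
      (torusLocalComponent L (IsCMField.complexConj L) v ξ.ψ) (pi2' (ext (ξ.xiLocalChar v))) (piN' (ext (ξ.xiLocalChar v)))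
    rw [xiDict_xiLocalChar v hext ξ]
    exact (hk (torusLocalComponent L (IsCMField.complexConj L) v ξ.η, torusLocalComponent L (IsCMField.complexConj L) v ξ.ψ)
      (continuous_torusLocalComponent L (IsCMField.complexConj L) ξ.η) (continuous_torusLocalComponent L (IsCMField.complexConj L) ξ.ψ)).1
  · intro 𝔇 hpi2 hpiN hμGZ
    exact keysFields_sockets 𝔇 μZ hL2 hpi2 hpiN hμGZ
  · -- (e): the labels at the extracted (continuous) pair `ext ξ′`
    exact (hk (ext ξ') (hcont ξ').1 (hcont ξ').2).1

end LabelFields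

end Summit.HodgeConjecture.HodgeConjecture.Cruxes.H413.F0P3cStCharTSXiDict

end
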